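import Summits.AnomalousDissipation.AnomalousDissipation.Theorems.MarginalStabilityChainStrainedLayerLawClockComposition
import Summits.AnomalousDissipation.AnomalousDissipation.Theorems.MarginalStabilityChainStrainedLayerLawClockStubCirculationFloor
import Summits.AnomalousDissipation.AnomalousDissipation.Theorems.MarginalStabilityChainStrainedLayerLawClockStubLevelSetNull
import Summits.AnomalousDissipation.AnomalousDissipation.Theorems.MarginalStabilityChainStrainedLayerLawClockStubNegEnstrophyLaw
import Summits.AnomalousDissipation.AnomalousDissipation.Theorems.MarginalStabilityChainStrainedLayerLawClockStubNegEnstrophyApriori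
import Summits.AnomalousDissipation.AnomalousDissipation.Theorems.MarginalStabilityChainStrainedLayerLawSumRuleShearTails
import HarnessLib.Audit

/-!
# Line `FirstLemmasR2K4` (log-enstrophy clock + Nash roundness) — lead's skeleton v2 for crux
# `MarginalStabilityChain.StrainedLayerLaw` (item stmt-AnomalousDissipation-3007, route route-AnomalousDissipation-MarginalStabilityChain; lead a2)

Crux (FIXED; `Theses/MarginalStabilityChain.lean`): `∃ c > 0 ∀ L > 0 ∃ ν₀ > 0 ∃ θ` admissible `∀ ν ∈ (0,ν₀] ∀ (u,v,p)`
global classical solutions of the stretched 2-D Navier–Stokes class (γ = ΔU = 1, period `L`) from `U_B^ν + θ`: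
`ofReal (c·min L 1) ≤ liminf_T ofReal T⁻¹ ∫⁻_{(0,T]} D`.

## The line (one paragraph)
Along every classical solution of the class with shear tails the enstrophy of the NEGATIVE vorticity obeys the exact,
interface-free law `Ω₋′ = Ω₋ − 2νP₋` (B1 `stub_negEnstrophyLaw`, LANDED p126337 with tools A–E p125623/p125715/p125826/
p125994/p126165; it consumes the measure-zero lemma `stub_levelSetNull`, LANDED p125255), so `(log Ω₋)′ = 1 − 2νP₋/Ω₋` is a
CLOCK; with the circulation floor `M₋ ≥ L` (B2 `stub_circulationFloor`, LANDED p125277), the fixed-ν bound `Ω₋ ≤ B` for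
`t ≥ 1` and `M₋ > 0 ⇒ Ω₋ > 0` (`stub_negEnstrophyApriori`, LANDED p125290) and ONE dynamical statement — the eventual NASH
ROUNDNESS FLOOR `(r⋆ min(L,1)/L)·M₋²P₋ ≤ Ω₋²` for every finite-dissipation tailed member from one admissible `θ` (B3
`stub_roundnessFloor`, HARDEST, the crux's ν-uniform infinite-time dynamics in scale-free dress; the lead holds it) — the
landed `clockTransfer`, `ofReal_negEnstrophy_le` (`ofReal(νΩ₋) ≤ 2·ofReal L·D`, pointwise) and `floorTransfer_direct`
(vocabulary/transfer file `…ClockLine.lean`, p124873) give the crux with `c = r⋆/4` through the landed conditional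
composition `StrainedLayerLaw_of_clockStubs` (`…ClockComposition.lean`, p124965). Hygiene (`stub_bareClassTails`, the
sum-rule line's registered signature VERBATIM; repair-only in the bare class — conditional closure
`bareClassTails_of_hasShearLayerTails`, p120875, imported above for the record) supplies the tails from local finiteness of
the dissipation; the `⊤`-dichotomy sits inside `floorTransfer_direct`.

## Status (lead c7, 2026-08-17, cycle 1): unchanged stub set (H + B3 open). NEW, landed as registered sub-goals of this line — the
EXACT ν-UNIFORM ALL-TIME LAWS of the tailed class (every classical solution with shear tails on compact time windows; files
`Theorems/MarginalStabilityChainStrainedLayerLawClock{NegMassAntitone p133000 (`negMass_antitone`: t ↦ M₋(t) non-increasing — hence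
M₊ = M₋ − L and ‖ω‖₁ = 2M₋ − L too: one-way cancellation), NegEnstrophyExpLaw p133051 (`negEnstrophy_exp_law`: Ω₋(t) ≤ e^{t−s}Ω₋(s),
∫_s^t 2νP₋ ≤ e^{t−s}Ω₋(s)), EnstrophyWindowCeiling p133142 (`enstrophy_window_ceiling`: Ω(t) ≤ e^{t−s}Ω(s) and the FINITE-WINDOW DISSIPATION
CEILING ∫⁻_{(s,t]} D ≤ ofReal((ν/L)Ω(s)(e^{t−s} − 1)) — an O(1) floor cannot come from any fixed window after the laminar scale νΩ ≍ L√ν: the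
content of the crux lives at t ≳ ½log(1/ν), in the eternal regime), CentroidLawTools p133705 + CentroidLaw p134031 (`vorticity_centroid_law`:
∫∫yω(t) = e^{−(t−s)}∫∫yω(s) EXACTLY; tools: ∫∫ωv = 0, d/dτ∫∫ωψ(y) for general weights), CirculationDensityLawTools p134857 + CirculationDensityLaw
p135108 (`circulationDensity_weak_law`: the weak form of ∂ₜγ = ∂ₓₓ(Π + νγ), γ = −∫ω dy the circulation density, Π = ∫uv dy the column Reynolds
stress — the only exact law governing the x-DISTRIBUTION of circulation), EnstrophyClockExactTools p134879 + EnstrophyClockExact p135125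
(`enstrophy_clock_exact`: Ω(t) − Ω(s) = ∫_s^t(Ω − 2νP) exactly; the ν-FREE kinematic floor Ω·∫∫|y||ω| ≥ L²/16; the EXACT clock mean law
|(T − 1) − ∫_1^T 2νP/Ω| ≤ K, i.e. ⟨P/Ω⟩ = 1/(2ν)), SecondMomentLawTools p134872 + SecondMomentLaw p135046 (`secondMoment_law`: I₂′ = −2I₂ + 2Π − 2νL
for I₂ = ∫∫y²ω, Π = ∫∫uv — in the mean ⟨Π⟩ = ⟨I₂⟩ + νL: Reynolds stress ↔ enstrophy-thickness)}`. Consequences for B3: M₋(t) ↓ M₋(∞) ≥ L exists;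
mean dissipation ν⟨Ω⟩/L = 2ν²⟨P⟩/L (the plasmoid law is a PALINSTROPHY floor ν²⟨P⟩ ≳ L·min(L,1)); any proof must work in the eternal regime.
More (later waves): faces of the windowed dissipation p135399; minimal reduction/converse p135624/p135643 and, UNDER THE CLASS REPAIR, the kernel-checked EQUIVALENCE
`strainedLayerLaw_iff_enstrophyMeanFloor` p137845 (StrainedLayerLaw ↔ enstrophy mean floor); steady corollaries p135646; M₋ → m ≥ L p135626; global nonlinear ENERGY
RELAMINARISATION of the Burgers layer for L²(3πν+2) ≤ 16π³ν² p137383 (+tools p136441/p136729/p137072) with laminar mean p136287 and no-witness corollary p137614.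
DNS (kit j021356, v2): complete coarsening to ONE Burgers core per period, D∞ = L/8π (0.988…1.0000×) and r₂ = 1/4π, for L = 1, 2, 4 (ν = 2e-3, 1e-3) and L = 2 (ν = 3e-4);
L = 8 mid-cascade at T = 80 (N = 2, D = 0.53·L/8π; continuation j023619); quantised one-way staircase 4πN·r₂ ≈ 1; the floor c·min(L,1) and B3's min(L,1)/L are conservative in L
(NUMERICS-c7.md).

## Status (lead c6, 2026-08-17, cycle 1): unchanged stub set (H + B3 open). NEW, landed as registered sub-goals of this line
(the B3-LEVEL IMAGE of the parallel-relaxation negative; files `Theorems/MarginalStabilityChainStrainedLayerLaw{ParallelRelaxStubCaloricTails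
p131798 (uniform exponential bounds for the strained caloric function and its y/yy/t derivatives on compact time ranges),
ParallelRelaxShearTails p131735 (the parallel member `U_B^ν + P` lies in the REPAIRED class `HasShearLayerTails`), ClockMemberTransfer
p131619 (the clock composition PER MEMBER: eventual roundness `r₀M₋²P₋ ≤ Ω₋²` along one tailed solution ⇒ `ofReal (r₀L/4) ≤
meanLayerDissipation`), ParallelRelaxMeanDissipation p131657 (finite dissipation + mean = `ofReal (√ν/(2√π))` of the explicit member),
ClockRoundnessXIndependent p131886 (`roundnessFloor_xIndependent_false`)}`): `stub_roundnessFloor` with its `∃ θ` restricted to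
x-INDEPENDENT admissible θ is FALSE for every `r`, UNCONDITIONALLY (the witness member's tails are verified, not assumed). With
p127935 (θ = 0) and p130190 (crux level): the witness θ of B3 must depend on `x` — roundness has to be CREATED by roll-up — and the
negatives survive the recommended class repair.

## Status (lead c5, 2026-08-16/17, cycle 1): unchanged stub set (H + B3 open). NEW, landed as registered sub-goals of this line
(the PARALLEL-RELAXATION package = the disprover's §4 made unconditional and importable; files
`Theorems/MarginalStabilityChainStrainedLayerLawParallelRelax{StubCesaro p129434, StubHeatGradient p129512, StubClassTools p129557,
StubCaloric p129680, StubTools p129806, Member p130049, (Final: parallelMember_meanLayerDissipation + strainedLayerLaw_xIndependent_false)}`):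
for every `ν > 0`, `L > 0` and every admissible x-INDEPENDENT `θ` the class `InCruxClass ν L θ₁ θ₂` contains the explicit parallel
member `U_B^ν + P` (strained shear diffusion `P(t,y) = (e^{s(t)Δ}g)(eᵗy)`, `s = ν(e^{2t}−1)/2`, Majda–Bertozzi 2002 (1.34)) whose
`meanLayerDissipation` is EXACTLY the Sweet–Parker rung `ofReal (√ν/(2√π))`; hence the crux with `∃θ` restricted to x-independent θ is
FALSE. So the witness θ of the crux AND of B3 below must depend on `x` (certified in the tree, not only in a workfile).

## Status (lead a2, 2026-08-16, end of cycle 1): OPEN = stub_bareClassTails (hygiene, blocked/repair-only) + stub_roundnessFloor (the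
crux's dynamics). Everything else of the line is a theorem (wave 1: four workers, four stubs landed in 35 min; nine files). Hence,
kernel-checked: `StrainedLayerLaw ⇐ stub_bareClassTails ∧ stub_roundnessFloor` (also landed as the two-hypothesis reduction
`StrainedLayerLaw_of_roundnessFloor`, `…ClockReduction.lean`), and under the recommended class repair (`HasShearLayerTails`
appended to 3007's class) `StrainedLayerLaw ⇐ stub_roundnessFloor` alone.
-/

-- `Summit.<Summit>.<Problem>` is the tree's mandated summit-side namespace (CONVENTIONS §2); for this
-- single-conjunct summit the two coincide, so the duplicate is deliberate.
set_option linter.dupNamespace false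

noncomputable section

open scoped Topology ENNReal
open Filter Set Function MeasureTheory

namespace Summit.AnomalousDissipation.AnomalousDissipation.Theorems.StrainedLayerLaw.LogEnstrophyClock

open Literature.Analysis.FluidPDE Literature.Analysis.FluidPDE.StretchedLayer
open Summit.AnomalousDissipation.AnomalousDissipation.Theses.MarginalStabilityChain
open Summit.AnomalousDissipation.AnomalousDissipation.Theorems.StrainedLayerLaw.StrainWorkSumRule

/-! ## The open stubs (registered; `sorry` only here) -/

/-- **Stub H — TAILS IN THE BARE CLASS (hygiene; the sum-rule line's registered signature VERBATIM; CONJECTURAL in the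
bare class, repair-only).** Every member of the crux's BARE classical class from `U_B^ν + θ` (θ admissible) whose
dissipation is locally integrable in time has uniform exponential shear tails on every compact `[a,b] ⊂ (0,∞)`. True for
the PHYSICAL solution; in the bare class it is the uniqueness/well-posedness debt (leads 0/c1/c2, Disproof §4/§7: explicit
parallel ghosts with an infinite dissipation burst show the bare class is non-unique; with finite dissipation no cheap
counterexample; a proof needs weak–strong uniqueness in the finite-dissipation bare class — open-technique, the Biot–Savart
nonlocality defeats transported-weight energy methods — plus existence of the tailed solution); under the recommended class
repair (`HasShearLayerTails u v` appended to 3007's hypotheses) it is the landed `bareClassTails_of_hasShearLayerTails`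
(p120875). SIZE: open in the bare class. [folklore] -/
theorem stub_bareClassTails : ∀ (ν L : ℝ), 0 < ν → 0 < L → ∀ (θ₁ θ₂ : ℝ → ℝ → ℝ), IsAdmissible L θ₁ θ₂ →
    ∀ (u v p : ℝ → ℝ → ℝ → ℝ), InCruxClass ν L θ₁ θ₂ u v p →
      (∀ T : ℝ, 0 < T → ∫⁻ t in Ioc 0 T, layerDissipation ν L (u t) (v t) ≠ ∞) →
        ∀ a b : ℝ, 0 < a → a < b → ExpTails (Icc a b) u v := by
  sorry

/-- **Stub B3 — THE ROUNDNESS FLOOR (HARDEST; the crux's open ν-uniform infinite-time dynamics in scale-free dress; the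
lead holds it).** There is a universal `r⋆ > 0` such that for every period `L` some `ν₀ > 0` and ONE ν-independent
admissible `θ` make every member of the class from `U_B^ν + θ`, `ν ≤ ν₀`, with locally finite dissipation and shear tails
on every `[a,b] ⊂ (0,∞)`, eventually NASH-ROUND: `(r⋆·min(L,1)/L)·M₋(t)²·P₋(t) ≤ Ω₋(t)²` for `t ≥ T₁` (`T₁` may depend on
ν and on the solution). Scale-free, amplitude-free, location-free, ν-free; one Gaussian core of any size has
`Ω₋²/(M₋²P₋) = 1/4π`, `N` far-apart equal cores `1/(4πN)` (whence the `min(L,1)/L`: a terminal row with `N ≍ max(1, L)`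
cores per period is allowed), an `x`-uniform sheet of thickness `δ` has `δ/(√π L) → 0` — so `θ = 0` (the laminar member,
`r ≍ √ν/L`, Disproof §2) and every `x`-independent `θ` (Disproof §4/§4b) are excluded: the witness `θ` must depend on
`x`, as the disprover demands. Equivalent to the crux modulo the landed stubs and the hygiene stub in the direction
`B3 ⇒ crux` (kernel-checked: `StrainedLayerLaw_of_roundnessFloor`); strictly stronger in logical form (pointwise-eventual
vs time-mean). Numerics FOR it: ideator toy DNS j019694/j019710 (`r₂ → 1/4π`, `D∞ = 0.94/0.99/1.00/1.04 × L/8π` at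
`ν = 4e-3…5e-4`, NUMERICS-r2k4.md), refuter DNS j005025 (`D∞/(L/8π) = 0.950/0.996/0.9997`, one steady core per period).
WHY IT MIGHT FAIL: exactly as the crux — relaminarisation / parking on sheet-like states for a sequence `ν_j → 0`,
late-time dust or filament-dominated palinstrophy, or a wild bare-class member; no theorem of this kind (ν-uniform,
infinite-time, every solution from one datum) exists for any Navier–Stokes flow. SIZE: open problem. [folklore] -/
theorem stub_roundnessFloor : ∃ r : ℝ, 0 < r ∧ ∀ L : ℝ, 0 < L → ∃ ν₀ : ℝ, 0 < ν₀ ∧ ∃ θ₁ θ₂ : ℝ → ℝ → ℝ,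
    IsAdmissible L θ₁ θ₂ ∧
    ∀ ν : ℝ, 0 < ν → ν ≤ ν₀ → ∀ (u v p : ℝ → ℝ → ℝ → ℝ), InCruxClass ν L θ₁ θ₂ u v p →
      (∀ T : ℝ, 0 < T → ∫⁻ t in Ioc 0 T, layerDissipation ν L (u t) (v t) ≠ ∞) →
      (∀ a b : ℝ, 0 < a → a < b → ExpTails (Icc a b) u v) →
        ∃ T₁ : ℝ, 0 < T₁ ∧ ∀ t : ℝ, T₁ ≤ t →
          r * min L 1 / L * negMass L (u t) (v t) ^ 2 * negPalinstrophy L (u t) (v t) ≤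
            negEnstrophy L (u t) (v t) ^ 2 := by
  sorry

/-! ## The composition: landed stubs B2, N, B1, A + open stubs H, B3 prove the crux BY NAME -/

/-- **Composition.** The four landed stubs (`stub_circulationFloor` p125277, `stub_levelSetNull` p125255,
`stub_negEnstrophyLaw` p126337, `stub_negEnstrophyApriori` p125290) and the two open stubs, fed to the landed conditional
composition `StrainedLayerLaw_of_clockStubs` (p124965), prove the crux by name (`c = r⋆/4`). [folklore] -/
theorem StrainedLayerLaw_of : StrainedLayerLaw :=
  StrainedLayerLaw_of_clockStubs stub_bareClassTails stub_circulationFloor stub_levelSetNull stub_negEnstrophyLaw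
    stub_negEnstrophyApriori stub_roundnessFloor

end Summit.AnomalousDissipation.AnomalousDissipation.Theorems.StrainedLayerLaw.LogEnstrophyClock

end
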